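import Summits.QuantumFields.YangMills.Theorems.BalabanUVNodesSpineReadingOfRecord13CoPHKRatioDominationBankedChrono

/-!
# N20 (NE7b) ON THE TOWER-FREE ROAD: THE COUNT'S MARGINS CHOSEN — the age datum `M·e^{−κ₁}·e^{η̄₊} < 1`, its ONE side condition and the root rate
# `Λ·e^{η̄₊−κ₁} < 1` displayed by ✓`…BankedChrono` are CHOICES of the bank rate `κ₁` and the renewal ∕ merger margin `E₀`, which enter `pub-balaban`'s count only through the banks and the
# infrared threshold — never through the printed raw factors `credit ∕ cost`, the consistency predicate or the windows in which the letters (a) and the labels (b) are stated (`rfl` ∕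
# structural induction); so they are STRUCK: margins `κ₁, E₀` and ONE threshold `x₀` exist BEFORE the family, the rank and the carriers, and the face holds with the letters stated in
# print's constants `C₀` — NO `Banking`, NO menus, NO age datum, NO side condition, NO root-rate hypothesis

Cell `pub-ymgap`, YM-PLAN Track A (HUMAN RULING D-0062); seat `pub-ymgap-dag-n20-d` (R134 (a) N20 NE7b s3), gen 42 — director-ym №374 line (E), road [e] TOWER-FREE of record (№377).
`--kind proof --supports stmt-QuantumFields-27366 --as helper` (K3⁸); COUNT-NEUTRAL; THEOREMS ONLY (0 `def`).  [LF-II] = [Balaban1989LargeFieldII]; [III] = [Balaban1988Convergent].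
Companions BY NAME: `…CoPHKRatioDominationBankedChrono.exists_irThreshold_relWeightBound_chronoGenealogies` (gen 42), `pub-balaban`'s `T4PrintedShapeBanking.{Consts, Consistent,
cost, credit}`, `T4CanonicalMenus.{birthMass, birthMass_nonneg}`.

WHY.  After ✓`…BankedChrono` the displayed census of road [e] read: (a) letters · (b) data + labels · (ID) multiplicities + caps + «the age datum, ONE side condition and the root rate
(entropy numerics)» · cells · flow + IR.  The three numerics constrain `(M, Λ, η̄₊; κ₁, E₀, birthMass)`; but `κ₁` (bank RATE) and `E₀` (renewal ∕ merger bank MARGIN) are parameters of the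
COUNT (`T4BankedInduction`'s banks `κ₁·W + E`), free in `T4PrintedShapeBanking.exists_irThreshold` for every valid value (a larger choice only raises the threshold `x₀`), and absent from
`credit`, `cost`, `Consistent`, `dictW`, `birthMass` (§1: `credit_withMargins`, `cost_withMargins`, `birthMass_withMargins` by `rfl`, `consistent_withMargins` by induction on the
genealogy).  Hence for ANY multiplicity base `M ≥ 0`, cell rate `Λ` and age slack `η̄₊ > 0` one may CHOOSE `κ₁ = η̄₊ + log(2(M + |Λ| + 1))`, `E₀ = log((e^{η̄₊} + birthMass)∕(e^{η̄₊} − 1))`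
(§1 `exists_countMargins`), and the face holds with the letters stated in print's constants `C₀` (§2).  The pins of record (birth cells := the boxes of the torus, flow couplings :=
the histories of record) follow in the sibling leaf `…BankedChronoOfRecord`.

WHAT IS PROVED (kernel; zero `sorry`).  §1 ★★ `exists_countMargins` (real arithmetic: `log`, `exp`), `credit_withMargins`, `cost_withMargins`, `birthMass_withMargins` (`rfl`),
`consistent_withMargins` (induction).  §2 ★★★ `exists_margins_irThreshold_relWeightBound_chronoGenealogies`: for print's valid constants `C₀` (`a, A₀, μ > 0`), `L ≥ 1`, `β₀ ≥ 0`,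
`r(q′+1) < p₀`, ANY `M ≥ 0`, `Λ > 0`, `η̄₊ > 0`: `∃ κ₁ E₀ x₀`, `κ₁, E₀ ≥ 0`, `Λ·e^{η̄₊−κ₁} < 1`, such that for EVERY family, rank, carrier tuple `(θ, hP, K₀, g₀, os, kr, bd)`, `V ≥ 0`, cut
(`j⋆(K) ≤ K`, `c·K ≤ K − j⋆(K)`), cells `#Cell a ≤ V·Λ^a`, per-level runs `(R K, g K, β′ K)` of the typed (2.7) ∕ (2.9) ∕ (2.5) [III] with `1 ≤ log g_s⁻²`, `x₀ ≤ log g⁻²` at the level and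
a nonnegative profile, caps `Dcap, Ncap`, displayed measurability ∕ integrability, and per `(K, t)` EACH RUN's letters (a) with the factor clause IN `C₀`'s RAW FACTORS, removal ∕ fibre ∕
filing data and labels (b) (consistency in `C₀`), multiplicities (ID) ⇒ `RelWeightBound 1 (classSetK₁₃ …) (weightAK₁₃ …) (weightBK₁₃ …) (badClassK₁₃ … bd) (K ↦ 1 − exp(−S_K))`,
`S_K = birthMass C₀·e^{−κ₁}·V·r^{K − j⋆(K) + 1}∕(1 − r)`, `r = Λ·e^{η̄₊−κ₁}` — NO `Banking`, NO menus, NO age datum, NO side condition, NO root-rate hypothesis.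

WHAT STAYS DISPLAYED (the census of road [e] after this file; NOT PRINTED as theorems of [LF-II] for `d = 4`, NOT proved here): (a) the fibrewise letters with the factor clause
`z s ≤ Π_{Y ∈ φ σ s} e^{−credits(G Y)}·e^{+lifeCost(G Y)}` (an ESTIMATE; junction NC-NE7b-α UNRULED; `pub-balaban`'s R3′); (b) removal maps with good images, fibre injections, slot filing
and the genealogy LABELS (consistent ∕ well-formed ∕ pending ∕ chronological ∕ within the caps ∕ rooted at the slot) — a DEFINER object on def-T's index (post-campaign design memo per
№374); (ID) the fibre multiplicities `#fibre(slot, shape) ≤ M^{partnerAges}` and the caps `Dcap, Ncap`; the runs' typed (2.7) ∕ (2.9) ∕ (2.5) with `1 ≤ log g_s⁻²`, `x₀ ≤ log g⁻²` and a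
nonnegative profile (the node owners of the flow); the cells `#Cell a ≤ V·Λ^a`; the cut fraction `c`; that `C₀` are print's constants is READING (ID) (`pub-balaban`'s).

HONEST FRAMING.  [bookkeeping] + [numerics]: one real-arithmetic lemma, three `rfl`, one induction, one composition; no estimate.  NOTHING of Bałaban's is asserted; NO weight of
Bałaban's is bounded; NE7 ∕ NE7b ∕ NE7c NOT PRINTED for `d = 4` ∕ NOT proved; no `Provisos₁₃CoPH` inhabitant claimed (K0⁷ OPEN); K3⁸ untouched; N20 NOT discharged; counts UNMOVED (typed
28∕28 · discharged 8∕27); one finite four-torus programme at fixed `ε` — NOT ℝ⁴, NOT OS, NOT a mass gap, NOT the Clay problem.  No `def`, no `instance`, no `notation`, no `sorry`; no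
decl below carries a cite tag.
-/

noncomputable section

open MeasureTheory
open scoped BigOperators
open Finset

namespace YMDAG.UVSplit

open Literature.MathematicalPhysics.QuantumFieldTheory.Balaban1983to89
open Literature.MathematicalPhysics.QuantumFieldTheory.Balaban1983to89.T4Continuum
open Literature.MathematicalPhysics.QuantumFieldTheory.Balaban1983to89.Node00
open Literature.MathematicalPhysics.QuantumFieldTheory.Balaban1983to89.B15.BasicStep (fibreIntegral)
open T4WeightBudget (RelWeightBound)
open T4PersistenceDictionary (Gen PEv dictW)
open T4BankedInduction (Banking credits lifeCost)
open T4PartnerMultiplicity (partnerAges)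
open T4BranchingRecordsGas (relabel shape)
open T4PrintedShapeBanking (Consistent)
open T4CanonicalMenus (Chrono fuel canonFam birthMass birthMass_nonneg)

variable {F : T4Family} {N : ℕ} [NeZero N]

/-! ## §1 The count's free margins: the age datum, its ONE side condition and the root rate are CHOICES of `κ₁, E₀` -/

section Margins

/-- ★★ **THE COUNT MARGINS EXIST**: for any multiplicity base `M ≥ 0`, any cell rate `Λ`, any birth mass `bm ≥ 0` and any age slack `η > 0` there are a bank rate `κ₁ ≥ 0` and a
renewal ∕ merger bank margin `E₀ ≥ 0` with the root rate `Λ·e^{η−κ₁} < 1`, the age datum `M·e^{−κ₁}·e^{η} < 1` and the ONE side condition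
`(e^{−E₀} + e^{−E₀}·bm·(Me^{−κ₁}∕(1 − Me^{−κ₁}e^{η})))·e^{η} ≤ e^{η} − 1` — explicitly `κ₁ = η + log(2(M + |Λ| + 1))`, `E₀ = log((e^{η} + bm)∕(e^{η} − 1))`.  (`κ₁, E₀` enter
`pub-balaban`'s count only through the banks `κ₁·W + E` and the infrared threshold, never through the printed raw factors `credit ∕ cost` or `Consistent ∕ dictW` in which the letters
(a) are stated — so they are the count's to choose.) [numerics] -/
theorem exists_countMargins {M Λ bm η : ℝ} (hM : 0 ≤ M) (hbm : 0 ≤ bm) (hη : 0 < η) :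
    ∃ κ₁ E₀ : ℝ, 0 ≤ κ₁ ∧ 0 ≤ E₀ ∧ Λ * Real.exp (η - κ₁) < 1 ∧ M * Real.exp (-κ₁) * Real.exp η < 1 ∧
      (Real.exp (-E₀) + Real.exp (-E₀) * bm * (M * Real.exp (-κ₁) / (1 - M * Real.exp (-κ₁) * Real.exp η))) * Real.exp η ≤
        Real.exp η - 1 := by
  set D : ℝ := 2 * (M + |Λ| + 1) with hD
  have hΛ : Λ ≤ |Λ| := le_abs_self Λ
  have hΛ0 : 0 ≤ |Λ| := abs_nonneg Λ
  have hD1 : (1 : ℝ) ≤ D := by rw [hD]; linarith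
  have hDpos : 0 < D := by linarith
  have heη : η + 1 < Real.exp η := Real.add_one_lt_exp (ne_of_gt hη)
  have he1 : 0 < Real.exp η - 1 := by linarith
  set A : ℝ := (Real.exp η + bm) / (Real.exp η - 1) with hA
  have hA1 : 1 ≤ A := by
    rw [hA, le_div_iff₀ he1]; linarith
  have hApos : 0 < A := by linarith
  have hk : Real.exp (-(η + Real.log D)) = Real.exp (-η) / D := by
    rw [neg_add, Real.exp_add, Real.exp_neg (Real.log D), Real.exp_log hDpos, div_eq_mul_inv]
  have hθ : M * Real.exp (-(η + Real.log D)) * Real.exp η = M / D := by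
    rw [hk, show M * (Real.exp (-η) / D) * Real.exp η = M / D * (Real.exp (-η) * Real.exp η) by ring, ← Real.exp_add,
      neg_add_cancel, Real.exp_zero, mul_one]
  have hMD : M / D ≤ 1 / 2 := by
    rw [div_le_iff₀ hDpos, hD]; linarith
  have hE : Real.exp (-Real.log A) = A⁻¹ := by rw [Real.exp_neg, Real.exp_log hApos]
  refine ⟨η + Real.log D, Real.log A, ?_, Real.log_nonneg hA1, ?_, ?_, ?_⟩
  · have := Real.log_nonneg hD1; linarith
  · rw [show η - (η + Real.log D) = -Real.log D by ring, Real.exp_neg, Real.exp_log hDpos]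
    rw [mul_inv_lt_iff₀ hDpos, hD]; linarith
  · rw [hθ]; linarith
  · -- the side condition
    set θ' : ℝ := M * Real.exp (-(η + Real.log D)) with hθ'
    have hθ'0 : 0 ≤ θ' := mul_nonneg hM (Real.exp_pos _).le
    have hθ'η : θ' * Real.exp η ≤ 1 / 2 := by rw [hθ', hθ]; exact hMD
    have hden : 1 / 2 ≤ 1 - θ' * Real.exp η := by linarith
    have hratio : θ' / (1 - θ' * Real.exp η) ≤ 2 * θ' := by
      rw [div_le_iff₀ (by linarith)]; nlinarith
    have h2θ : 2 * θ' ≤ Real.exp (-η) := by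
      have h := mul_le_mul_of_nonneg_right hθ'η (Real.exp_pos (-η)).le
      rw [mul_assoc, ← Real.exp_add, add_neg_cancel, Real.exp_zero, mul_one] at h
      linarith
    have hA' : 0 ≤ A⁻¹ := inv_nonneg.mpr hApos.le
    calc (Real.exp (-Real.log A) + Real.exp (-Real.log A) * bm * (θ' / (1 - θ' * Real.exp η))) * Real.exp η
        = A⁻¹ * (1 + bm * (θ' / (1 - θ' * Real.exp η))) * Real.exp η := by rw [hE]; ring
      _ ≤ A⁻¹ * (1 + bm * Real.exp (-η)) * Real.exp η := by
          have : bm * (θ' / (1 - θ' * Real.exp η)) ≤ bm * Real.exp (-η) := mul_le_mul_of_nonneg_left (hratio.trans h2θ) hbm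
          have h3 : 0 ≤ A⁻¹ * Real.exp η := mul_nonneg hA' (Real.exp_pos _).le
          nlinarith
      _ = A⁻¹ * (Real.exp η + bm) := by
          rw [mul_assoc, add_mul, one_mul, mul_assoc bm, ← Real.exp_add, neg_add_cancel, Real.exp_zero, mul_one]
      _ = Real.exp η - 1 := by
          rw [hA, inv_div, div_mul_cancel₀]
          exact ne_of_gt (by linarith)

/-- Changing the margins `κ₁, E₀` does not change the printed RAW CREDITS (`rfl`). [bookkeeping] -/
theorem credit_withMargins (C₀ : T4PrintedShapeBanking.Consts) (κ₁ E₀ : ℝ) :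
    T4PrintedShapeBanking.credit ({ C₀ with κ₁ := κ₁, E₀ := E₀ } : T4PrintedShapeBanking.Consts) = T4PrintedShapeBanking.credit C₀ := rfl

/-- … nor the per-step CONTROL COSTS (`rfl`). [bookkeeping] -/
theorem cost_withMargins (C₀ : T4PrintedShapeBanking.Consts) (κ₁ E₀ : ℝ) :
    T4PrintedShapeBanking.cost ({ C₀ with κ₁ := κ₁, E₀ := E₀ } : T4PrintedShapeBanking.Consts) = T4PrintedShapeBanking.cost C₀ := rfl

/-- … nor the BIRTH MASS (`rfl`). [bookkeeping] -/
theorem birthMass_withMargins (C₀ : T4PrintedShapeBanking.Consts) (κ₁ E₀ : ℝ) :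
    birthMass ({ C₀ with κ₁ := κ₁, E₀ := E₀ } : T4PrintedShapeBanking.Consts) = birthMass C₀ := rfl

/-- … nor the CONSISTENCY predicate (it reads `n₁` only; structural induction). [bookkeeping] -/
theorem consistent_withMargins (C₀ : T4PrintedShapeBanking.Consts) (κ₁ E₀ : ℝ) (K : ℕ) (R : ℕ → ℕ) :
    Consistent ({ C₀ with κ₁ := κ₁, E₀ := E₀ } : T4PrintedShapeBanking.Consts) K R = Consistent C₀ K R := by
  funext G
  induction G with
  | born b j => rfl
  | renew G e h ih => simp only [T4PrintedShapeBanking.Consistent, ih]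
  | merge X Y e ihX ihY => simp only [T4PrintedShapeBanking.Consistent, ihX, ihY]

end Margins

/-! ## §2 The face with the margins chosen: numerics struck, letters in print's constants `C₀` -/

section MarginsFace

open scoped Classical in
/-- ★★★ **THE N20 FACE ON THE TOWER-FREE ROAD WITH THE BANKING AND THE NUMERICS STRUCK** (`exists_countMargins` + ✓`exists_irThreshold_relWeightBound_chronoGenealogies` at the constants
`{C₀ with κ₁, E₀}`, whose printed raw factors, consistency predicate, windows and birth mass ARE `C₀`'s by `rfl`): for print's symbolic constants `C₀` (valid, `a, A₀, μ > 0`), block size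
`L ≥ 1`, `β₀ ≥ 0`, `r(q′+1) < p₀`, ANY multiplicity base `M ≥ 0`, cell rate `Λ > 0` and age slack `η̄₊ > 0` there are margins `κ₁, E₀ ≥ 0` with `Λ·e^{η̄₊−κ₁} < 1` and ONE threshold `x₀`
— all BEFORE the family, the rank and the carriers — such that for EVERY carrier tuple, `V ≥ 0`, cut, cells `#Cell a ≤ V·Λ^a`, per-level runs of the typed (2.7) ∕ (2.9) ∕ (2.5) with
`1 ≤ log g_s⁻²`, `x₀ ≤ log g⁻²` at the level and a nonnegative profile, caps, the letters (a) IN `C₀`'s RAW FACTORS, data and labels (b) (consistency in `C₀`), multiplicities (ID) ⇒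
`RelWeightBound 1 … (K ↦ 1 − exp(−S_K))`, `S_K = birthMass C₀·e^{−κ₁}·V·r^{K − j⋆(K) + 1}∕(1 − r)`, `r = Λ·e^{η̄₊−κ₁}` — NO age datum, NO side condition, NO root-rate hypothesis.
[bookkeeping] -/
theorem exists_margins_irThreshold_relWeightBound_chronoGenealogies {X γ : Type*} [DecidableEq γ] (C₀ : T4PrintedShapeBanking.Consts) (hCv : C₀.Valid) (ha : 0 < C₀.a)
    (hA : 0 < C₀.A₀) (hμ₀ : 0 < C₀.μ) {L r : ℕ} (hL : 1 ≤ L) {β₀ : ℝ} (hβ : 0 ≤ β₀) (hrq : r * (C₀.q' + 1) < C₀.p₀) {M Λ ηplus : ℝ} (hM : 0 ≤ M) (hΛ : 0 < Λ)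
    (hη : 0 < ηplus) :
    ∃ κ₁ E₀ x₀ : ℝ, 0 ≤ κ₁ ∧ 0 ≤ E₀ ∧ Λ * Real.exp (ηplus - κ₁) < 1 ∧
      ∀ {F : T4Family} {N : ℕ} [NeZero N] (θ : Stage13HParams F N) (hP : θ.Provisos₁₃CoPH F N) (K₀ : ℕ) (g₀ : ℕ → ℝ) (os : List (ULoop F))
      (kr : ℕ → (Σ K, SiteSeqKey F (K₀ + K)) → (Σ K, SiteSeqKey F (K₀ + K))) (bd : ℕ → (Σ K, SiteSeqKey F (K₀ + K)) → Prop) (V c : ℝ), 0 ≤ V → 0 < c →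
      ∀ (jstar : ℕ → ℕ), (∀ K, jstar K ≤ K) → (∀ K : ℕ, c * K ≤ ((K - jstar K : ℕ) : ℝ)) →
      ∀ (Cell : ℕ → Finset γ), (∀ a, ((Cell a).card : ℝ) ≤ V * Λ ^ a) →
      ∀ (R : ℕ → ℕ → ℕ) (g : ℕ → ℕ → ℝ) (β' : ℕ → ℝ),
        (∀ K, B14.FlowIneq27 (g K) (β' K) β₀ C₀.p₀ (K₀ + K)) → (∀ K, B14FlowStep.FlowIneq29 (R K) (g K) L (β' K) β₀ (K₀ + K)) →
        (∀ K s, s ≤ K₀ + K → B14.IsRj L r (g K s) (R K s)) → (∀ K s, s ≤ K₀ + K → 1 ≤ Real.log ((g K s) ^ 2)⁻¹) →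
        (∀ K, x₀ ≤ Real.log ((g K (K₀ + K)) ^ 2)⁻¹) → (∀ K j, 0 ≤ p0Profile C₀.A₀ C₀.p₀ (g K j)) →
      ∀ (Dcap Ncap : ℕ → ℕ),
      (∀ K t s, Measurable fun V => chiSeqOfRecord F N θ.ν θ.τ9.M (histA₁₃ θ K₀ g₀ K) (K₀ + K) (K₀ + K) s V *
        dressedSlotsOfDatum₉ F N θ.toStage9Params (datumOfRecord₁₃CoPH F N θ hP) g₀ os t (runA₁₃ F K₀ g₀ K) (histA₁₃ θ K₀ g₀ K) (K₀ + K) s V) →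
      (∀ K t s, Integrable (fun V => chiSeqOfRecord F N θ.ν θ.τ9.M (histA₁₃ θ K₀ g₀ K) (K₀ + K) (K₀ + K) s V *
        dressedSlotsOfDatum₉ F N θ.toStage9Params (datumOfRecord₁₃CoPH F N θ hP) g₀ os t (runA₁₃ F K₀ g₀ K) (histA₁₃ θ K₀ g₀ K) (K₀ + K) s V)
        (fieldMeasure (F.P (K₀ + K)) (K₀ + K) (SU N))) →
      (∀ K t s', Measurable fun V => chiSeqOfRecord F N θ.ν θ.τ9.M (histB₁₃ θ K₀ g₀ K) (K₀ + K + 1) (K₀ + K + 1) s' V *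
        dressedSlotsOfDatum₉ F N θ.toStage9Params (datumOfRecord₁₃CoPH F N θ hP) g₀ os t (runB₁₃ F K₀ g₀ K) (histB₁₃ θ K₀ g₀ K) (K₀ + K + 1) s' V) →
      (∀ K t s', Integrable (fun V => chiSeqOfRecord F N θ.ν θ.τ9.M (histB₁₃ θ K₀ g₀ K) (K₀ + K + 1) (K₀ + K + 1) s' V *
        dressedSlotsOfDatum₉ F N θ.toStage9Params (datumOfRecord₁₃CoPH F N θ hP) g₀ os t (runB₁₃ F K₀ g₀ K) (histB₁₃ θ K₀ g₀ K) (K₀ + K + 1) s' V)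
        (fieldMeasure (F.P (K₀ + K + 1)) (K₀ + K + 1) (SU N))) →
      (∀ (K : ℕ) (t : ℝ), |t| ≤ 1 →
        ∃ (rm : SeqOfRecord F θ.ν θ.τ9.M (histA₁₃ θ K₀ g₀ K) (K₀ + K) (K₀ + K) → SeqOfRecord F θ.ν θ.τ9.M (histA₁₃ θ K₀ g₀ K) (K₀ + K) (K₀ + K))
          (fib : SeqOfRecord F θ.ν θ.τ9.M (histA₁₃ θ K₀ g₀ K) (K₀ + K) (K₀ + K) → Finset (PBond (F.P (K₀ + K)) (K₀ + K)))
          (z : SeqOfRecord F θ.ν θ.τ9.M (histA₁₃ θ K₀ g₀ K) (K₀ + K) (K₀ + K) → ℝ) (Old : SeqOfRecord F θ.ν θ.τ9.M (histA₁₃ θ K₀ g₀ K) (K₀ + K) (K₀ + K) → Finset X)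
          (φ : SeqOfRecord F θ.ν θ.τ9.M (histA₁₃ θ K₀ g₀ K) (K₀ + K) (K₀ + K) → SeqOfRecord F θ.ν θ.τ9.M (histA₁₃ θ K₀ g₀ K) (K₀ + K) (K₀ + K) → Finset X)
          (slot : X → (Σ _ : ℕ, γ)) (G : X → Gen PEv),
          (∀ s, kr K (keyA₁₃ θ K₀ g₀ K s) ∈ badClassK₁₃ θ K₀ g₀ kr bd K t → ∀ V,
            fibreIntegral (fib s) (fun V => chiSeqOfRecord F N θ.ν θ.τ9.M (histA₁₃ θ K₀ g₀ K) (K₀ + K) (K₀ + K) s V *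
                dressedSlotsOfDatum₉ F N θ.toStage9Params (datumOfRecord₁₃CoPH F N θ hP) g₀ os t (runA₁₃ F K₀ g₀ K) (histA₁₃ θ K₀ g₀ K) (K₀ + K) s V) V ≤
              z s * fibreIntegral (fib s) (fun V => chiSeqOfRecord F N θ.ν θ.τ9.M (histA₁₃ θ K₀ g₀ K) (K₀ + K) (K₀ + K) (rm s) V *
                dressedSlotsOfDatum₉ F N θ.toStage9Params (datumOfRecord₁₃CoPH F N θ hP) g₀ os t (runA₁₃ F K₀ g₀ K) (histA₁₃ θ K₀ g₀ K) (K₀ + K) (rm s) V) V) ∧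
          (∀ s, kr K (keyA₁₃ θ K₀ g₀ K s) ∈ badClassK₁₃ θ K₀ g₀ kr bd K t → kr K (keyA₁₃ θ K₀ g₀ K (rm s)) ∉ badClassK₁₃ θ K₀ g₀ kr bd K t) ∧
          (∀ σ s, kr K (keyA₁₃ θ K₀ g₀ K s) ∈ badClassK₁₃ θ K₀ g₀ kr bd K t → rm s = σ → φ σ s ⊆ Old σ ∧ (φ σ s).Nonempty) ∧
          (∀ σ, Set.InjOn (φ σ) {s | kr K (keyA₁₃ θ K₀ g₀ K s) ∈ badClassK₁₃ θ K₀ g₀ kr bd K t ∧ rm s = σ}) ∧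
          (∀ σ s, kr K (keyA₁₃ θ K₀ g₀ K s) ∈ badClassK₁₃ θ K₀ g₀ kr bd K t → rm s = σ →
            z s ≤ ∏ Y ∈ φ σ s, Real.exp (-credits (T4PrintedShapeBanking.credit C₀ (g K)) (G Y)) *
              Real.exp (lifeCost (dictW (R K) C₀.n₁) (T4PrintedShapeBanking.cost C₀ (K₀ + K) (R K)) (G Y))) ∧
          (∀ σ, ∀ Y ∈ Old σ, (slot Y).1 < K₀ + jstar K) ∧ (∀ σ, ∀ Y ∈ Old σ, (slot Y).2 ∈ Cell ((K₀ + K) - (slot Y).1)) ∧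
          (∀ σ, ∀ Y ∈ Old σ, Consistent C₀ (K₀ + K) (R K) (G Y)) ∧ (∀ σ, ∀ Y ∈ Old σ, (G Y).WF (dictW (R K) C₀.n₁)) ∧
          (∀ σ, ∀ Y ∈ Old σ, K₀ + K < (G Y).reach (dictW (R K) C₀.n₁)) ∧ (∀ σ, ∀ Y ∈ Old σ, Chrono PEv.step (G Y)) ∧
          (∀ σ, ∀ Y ∈ Old σ, ∀ e ∈ (G Y).events, e.kind = 0 → e.fat < Dcap (K₀ + K)) ∧ (∀ σ, ∀ Y ∈ Old σ, fuel (G Y) ≤ Ncap (K₀ + K)) ∧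
          (∀ σ, ∀ Y ∈ Old σ, (G Y).rootStep = (slot Y).1) ∧
          (∀ σ, ∀ j < K₀ + jstar K, ∀ zc ∈ Cell ((K₀ + K) - j), ∀ G₀ ∈ canonFam Dcap Ncap (K₀ + K) j,
            ((((Old σ).filter fun Y => slot Y = ⟨j, zc⟩ ∧ relabel shape (G Y) = G₀).card : ℕ) : ℝ) ≤ M ^ partnerAges PEv.step G₀)) →
      (∀ (K : ℕ) (t : ℝ), |t| ≤ 1 →
        ∃ (rm : SeqOfRecord F θ.ν θ.τ9.M (histB₁₃ θ K₀ g₀ K) (K₀ + K + 1) (K₀ + K + 1) → SeqOfRecord F θ.ν θ.τ9.M (histB₁₃ θ K₀ g₀ K) (K₀ + K + 1) (K₀ + K + 1))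
          (fib : SeqOfRecord F θ.ν θ.τ9.M (histB₁₃ θ K₀ g₀ K) (K₀ + K + 1) (K₀ + K + 1) → Finset (PBond (F.P (K₀ + K + 1)) (K₀ + K + 1)))
          (z : SeqOfRecord F θ.ν θ.τ9.M (histB₁₃ θ K₀ g₀ K) (K₀ + K + 1) (K₀ + K + 1) → ℝ)
          (Old : SeqOfRecord F θ.ν θ.τ9.M (histB₁₃ θ K₀ g₀ K) (K₀ + K + 1) (K₀ + K + 1) → Finset X)
          (φ : SeqOfRecord F θ.ν θ.τ9.M (histB₁₃ θ K₀ g₀ K) (K₀ + K + 1) (K₀ + K + 1) → SeqOfRecord F θ.ν θ.τ9.M (histB₁₃ θ K₀ g₀ K) (K₀ + K + 1) (K₀ + K + 1) → Finset X)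
          (slot : X → (Σ _ : ℕ, γ)) (G : X → Gen PEv),
          (∀ s', kr K (keyB₁₃ θ K₀ g₀ K s') ∈ badClassK₁₃ θ K₀ g₀ kr bd K t → ∀ V,
            fibreIntegral (fib s') (fun V => chiSeqOfRecord F N θ.ν θ.τ9.M (histB₁₃ θ K₀ g₀ K) (K₀ + K + 1) (K₀ + K + 1) s' V *
                dressedSlotsOfDatum₉ F N θ.toStage9Params (datumOfRecord₁₃CoPH F N θ hP) g₀ os t (runB₁₃ F K₀ g₀ K) (histB₁₃ θ K₀ g₀ K) (K₀ + K + 1) s' V) V ≤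
              z s' * fibreIntegral (fib s') (fun V => chiSeqOfRecord F N θ.ν θ.τ9.M (histB₁₃ θ K₀ g₀ K) (K₀ + K + 1) (K₀ + K + 1) (rm s') V *
                dressedSlotsOfDatum₉ F N θ.toStage9Params (datumOfRecord₁₃CoPH F N θ hP) g₀ os t (runB₁₃ F K₀ g₀ K) (histB₁₃ θ K₀ g₀ K) (K₀ + K + 1) (rm s') V) V) ∧
          (∀ s', kr K (keyB₁₃ θ K₀ g₀ K s') ∈ badClassK₁₃ θ K₀ g₀ kr bd K t → kr K (keyB₁₃ θ K₀ g₀ K (rm s')) ∉ badClassK₁₃ θ K₀ g₀ kr bd K t) ∧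
          (∀ σ s', kr K (keyB₁₃ θ K₀ g₀ K s') ∈ badClassK₁₃ θ K₀ g₀ kr bd K t → rm s' = σ → φ σ s' ⊆ Old σ ∧ (φ σ s').Nonempty) ∧
          (∀ σ, Set.InjOn (φ σ) {s' | kr K (keyB₁₃ θ K₀ g₀ K s') ∈ badClassK₁₃ θ K₀ g₀ kr bd K t ∧ rm s' = σ}) ∧
          (∀ σ s', kr K (keyB₁₃ θ K₀ g₀ K s') ∈ badClassK₁₃ θ K₀ g₀ kr bd K t → rm s' = σ →
            z s' ≤ ∏ Y ∈ φ σ s', Real.exp (-credits (T4PrintedShapeBanking.credit C₀ (g (K + 1))) (G Y)) *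
              Real.exp (lifeCost (dictW (R (K + 1)) C₀.n₁) (T4PrintedShapeBanking.cost C₀ (K₀ + K + 1) (R (K + 1))) (G Y))) ∧
          (∀ σ, ∀ Y ∈ Old σ, (slot Y).1 < K₀ + jstar K + 1) ∧ (∀ σ, ∀ Y ∈ Old σ, (slot Y).2 ∈ Cell ((K₀ + K + 1) - (slot Y).1)) ∧
          (∀ σ, ∀ Y ∈ Old σ, Consistent C₀ (K₀ + K + 1) (R (K + 1)) (G Y)) ∧ (∀ σ, ∀ Y ∈ Old σ, (G Y).WF (dictW (R (K + 1)) C₀.n₁)) ∧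
          (∀ σ, ∀ Y ∈ Old σ, K₀ + K + 1 < (G Y).reach (dictW (R (K + 1)) C₀.n₁)) ∧ (∀ σ, ∀ Y ∈ Old σ, Chrono PEv.step (G Y)) ∧
          (∀ σ, ∀ Y ∈ Old σ, ∀ e ∈ (G Y).events, e.kind = 0 → e.fat < Dcap (K₀ + K + 1)) ∧ (∀ σ, ∀ Y ∈ Old σ, fuel (G Y) ≤ Ncap (K₀ + K + 1)) ∧
          (∀ σ, ∀ Y ∈ Old σ, (G Y).rootStep = (slot Y).1) ∧
          (∀ σ, ∀ j < K₀ + jstar K + 1, ∀ zc ∈ Cell ((K₀ + K + 1) - j), ∀ G₀ ∈ canonFam Dcap Ncap (K₀ + K + 1) j,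
            ((((Old σ).filter fun Y => slot Y = ⟨j, zc⟩ ∧ relabel shape (G Y) = G₀).card : ℕ) : ℝ) ≤ M ^ partnerAges PEv.step G₀)) →
      RelWeightBound 1 (classSetK₁₃ θ K₀ g₀ kr) (weightAK₁₃ θ hP K₀ g₀ os kr) (weightBK₁₃ θ hP K₀ g₀ os kr) (badClassK₁₃ θ K₀ g₀ kr bd)
        (fun K => 1 - Real.exp (-(birthMass C₀ * Real.exp (-κ₁) * V *
          ((Λ * Real.exp (ηplus - κ₁)) ^ (K - jstar K + 1) / (1 - Λ * Real.exp (ηplus - κ₁)))))) := by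
  obtain ⟨κ₁, E₀, hκ, hE, hr, h1, hside⟩ := exists_countMargins (Λ := Λ) (bm := birthMass C₀) hM (birthMass_nonneg hμ₀) hη
  have hCv' : T4PrintedShapeBanking.Consts.Valid ({ C₀ with κ₁ := κ₁, E₀ := E₀ } : T4PrintedShapeBanking.Consts) :=
    ⟨hCv.E₂_nonneg, hCv.E₃_nonneg, hκ, hE, hCv.Eb_nonneg, hCv.μ_nonneg, hCv.dC_le⟩
  obtain ⟨x₀, hx₀⟩ := exists_irThreshold_relWeightBound_chronoGenealogies (X := X) (γ := γ)
    ({ C₀ with κ₁ := κ₁, E₀ := E₀ } : T4PrintedShapeBanking.Consts) hCv' ha hA hμ₀ hL hβ hrq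
  simp only [credit_withMargins, cost_withMargins, birthMass_withMargins, consistent_withMargins] at hx₀
  refine ⟨κ₁, E₀, x₀, hκ, hE, hr, ?_⟩
  intro F N _ θ hP K₀ g₀ os kr bd V c hV hc jstar hjK hfrac Cell hcell R g β' h27 h29 hR hx1 hxK hprof Dcap Ncap hmA hintA hmB hintB hLA hLB
  exact hx₀ θ hP K₀ g₀ os kr bd V Λ ηplus M c hV hΛ hη.le hM hr h1 hside hc jstar hjK hfrac Cell hcell R g β' h27 h29 hR hx1 hxK hprof Dcap Ncap hmA hintA
    hmB hintB hLA hLB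

end MarginsFace

end YMDAG.UVSplit
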